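import Summits.NavierStokesRegularity.FluidComputer.PalasekTowerHostSchedule
import Literature.Analysis.FluidPDE.NSLerayHopfSereginEnergyProofs

/-!
# The BOX SCHEDULE: a pinned, rigid, quiet schedule on the wide-base rates from ANY smooth force supported in a compact box

Cell `ns-blowup`, seat `ns-blowup-ecbridge-3` (g3); GROUP C «BRIDGE SUPPORT» of the route
`PalasekTowerBreakdown` (crux `EpisodeBaseG`, item stmt-NavierStokesRegularity-19179, R2 of record:
`∃ S*, HostPreparationD (HostClass.exact S*) ∧ FirstEpisodeD (HostClass.exact S*)` for a NAMED design
`S*`). LABEL: E–C typing (KERNEL construction, generic). WHAT THIS IS NOT: not Navier–Stokes evidence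
— a schedule (datum, force, clock, constants, ball) is written down from given data; no flow, stage or
tower is constructed and nothing is asserted about any dynamics.

## What and why

Every level-`0` host design of the register (the Host series p418168 … p428335, the germ host of
`PalasekTowerGermHost*`, any future named `S*`) needs the SAME schedule around its force: the rigid
window clock of `PalasekTowerRegisterWindow` (`τ₀ = 1`, `τ_{k+1} = τ_k + 4bβ log N_{k+1}/A_k`,
`T = 1 + Σ_k w_k`, `c₃ = 32`), the registered constants `c₁ = 1`, `c₂ = 5/3`, `c₅ = 4bβ`, a push
constant `c₄ ≤ 1`, and the register clauses `Rigid` (by construction), `Quiet` (force `= 0` from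
`τ₁` on) and `Pins 8 (6/5)` (`Schedule.Rigid.pins_of_push_le_one`: any `c₄ ≤ 1` passes, given
confinement). `PalasekTowerHostSchedule.hostSchedule` (g0) hard-wires the Host series' force; this
file does it ONCE for arbitrary data:

* §1 Clay class from compact support: a force smooth on `ℝ × ℝ³` with compact space-time support has
  Fefferman's decay (5) (`hasRapidSpaceTimeDecay_of_hasCompactSupport`; the datum version is the
  tree's `HasRapidSpatialDecay.of_hasCompactSupport`);
* §2 `Schedule.ofBox u₀ F ρ c₄ …`: the schedule with datum `u₀` (smooth, compactly supported,
  confined to `B̄(0, ρ)`), force `F` (smooth on `ℝ × ℝ³`, compact support, confined to the ball, ZERO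
  FROM `τ₁ = Host.τfirst` ON, and `‖F‖ ≤ c₄ Y₀` on the first window `[1, τ₁]`), radius `ρ`, `c₄ ≤ 1`;
* §3 its field lemmas and the register clauses `ofBox_rigid`, `ofBox_quiet`, `ofBox_pins`.

So a design seat proving `HostPreparationD (HostClass.exact (Schedule.ofBox …))` only has to produce
the level-`0` STAGE (its flow on `[0, 1]`); the schedule side is this file.

References: S. Palasek, arXiv:2605.13827 §3.3 (the schedule of switching times) [cite: Palasek2026ElementaryModel, §3.3];
C. L. Fefferman, Clay problem description, (4)–(6) [cite: FeffermanClay2006, (4) (5) (6)].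
-/

noncomputable section

namespace Summit.NavierStokesRegularity.FluidComputer.PalasekTowerClayBridge

open Real Set Function Filter Topology Metric
open scoped ContDiff Topology ENNReal

open Literature.Analysis.FluidPDE

/-! ## §1 Clay class from compact space-time support -/

/-- **Clay (5) from compact support**: a force smooth on all of `ℝ × ℝ³` whose space-time support is
compact has Fefferman's space-time decay — on the closed half-space the within-derivatives are the
ordinary ones, each weighted derivative is continuous, hence bounded on the support, and vanishes off
it. [cite: FeffermanClay2006, (5)] -/
theorem hasRapidSpaceTimeDecay_of_hasCompactSupport
    {F : ℝ → EuclideanSpace ℝ (Fin 3) → EuclideanSpace ℝ (Fin 3)}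
    (hF : ContDiff ℝ ∞ (uncurry F)) (hFc : HasCompactSupport (uncurry F)) :
    HasRapidSpaceTimeDecay F := by
  intro n K
  set G := uncurry F with hGdef
  have hUD : UniqueDiffOn ℝ (Ici (0 : ℝ) ×ˢ (univ : Set (EuclideanSpace ℝ (Fin 3)))) :=
    (uniqueDiffOn_Ici 0).prod uniqueDiffOn_univ
  have hwithin : ∀ z ∈ Ici (0 : ℝ) ×ˢ (univ : Set (EuclideanSpace ℝ (Fin 3))),
      iteratedFDerivWithin ℝ n G (Ici (0 : ℝ) ×ˢ univ) z = iteratedFDeriv ℝ n G z := fun z hz =>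
    iteratedFDerivWithin_eq_iteratedFDeriv hUD (hF.contDiffAt.of_le (by exact_mod_cast le_top)) hz
  set Φ : ℝ × EuclideanSpace ℝ (Fin 3) → ℝ := fun z =>
    (1 + ‖z.2‖ + z.1) ^ K * ‖iteratedFDeriv ℝ n G z‖ with hΦdef
  have hΦc : Continuous Φ := by
    have h1 : Continuous fun z : ℝ × EuclideanSpace ℝ (Fin 3) => (1 + ‖z.2‖ + z.1) ^ K :=
      ((continuous_const.add continuous_snd.norm).add continuous_fst).pow K
    exact h1.mul (hF.continuous_iteratedFDeriv (m := n) (by exact_mod_cast le_top)).norm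
  have hΦs : HasCompactSupport Φ := ((hFc.iteratedFDeriv n).norm).mul_left
  obtain ⟨C, hC⟩ := hΦc.bounded_above_of_compact_support hΦs
  refine ⟨C, fun t ht x => ?_⟩
  have hz : ((t, x) : ℝ × EuclideanSpace ℝ (Fin 3)) ∈
      Ici (0 : ℝ) ×ˢ (univ : Set (EuclideanSpace ℝ (Fin 3))) :=
    mk_mem_prod ht (mem_univ _)
  rw [hwithin _ hz]
  have h := hC (t, x)
  simp only [hΦdef, Real.norm_eq_abs] at h
  exact le_trans (le_abs_self _) h

/-- **Clay (6) from global smoothness**: a force smooth on `ℝ × ℝ³` is smooth on the closed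
half-space. [cite: FeffermanClay2006, (6)] -/
theorem isSmoothOnHalfSpace_of_contDiff {F : ℝ → EuclideanSpace ℝ (Fin 3) → EuclideanSpace ℝ (Fin 3)}
    (hF : ContDiff ℝ ∞ (uncurry F)) : IsSmoothOnHalfSpace F :=
  hF.contDiffOn

/-! ## §2 The box schedule -/

/-- `τ₁ = Host.τfirst` lies strictly before the blow-up time `T = 1 + Σ_k w_k` of the window clock
(and so does every readout time). [folklore] -/
theorem windowTime_lt_T (k : ℕ) :
    Schedule.windowTime TowerRates.wide k < 1 + ∑' j, TowerRates.wide.window j := by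
  have hgeo := TowerRates.wide_window_geo
  have hs := (Schedule.window_tail_le (R := TowerRates.wide) (r := 1 / 3) (by norm_num) (by norm_num)
    hgeo 0).1
  simp only [add_zero] at hs
  have hsplit := hs.sum_add_tsum_nat_add k
  have htail := (Schedule.window_tail_le (R := TowerRates.wide) (r := 1 / 3) (by norm_num)
    (by norm_num) hgeo k).1
  have hpos : 0 < ∑' i, TowerRates.wide.window (i + k) := by
    have h1 : TowerRates.wide.window (0 + k) ≤ ∑' i, TowerRates.wide.window (i + k) :=
      htail.le_tsum 0 (fun j _ => (TowerRates.wide.window_pos (j + k)).le)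
    have h2 := TowerRates.wide.window_pos (0 + k)
    linarith
  unfold Schedule.windowTime
  linarith

/-- The Palasek clock of the window schedule: `T − τ_{k+1} ≤ 32 / A_k`. [folklore] -/
theorem T_sub_windowTime_le (k : ℕ) :
    (1 + ∑' j, TowerRates.wide.window j) - Schedule.windowTime TowerRates.wide (k + 1) ≤
      32 / TowerRates.wide.A k := by
  have hgeo := TowerRates.wide_window_geo
  have hclock := TowerRates.wide_window_clock
  have hs := (Schedule.window_tail_le (R := TowerRates.wide) (r := 1 / 3) (by norm_num) (by norm_num)
    hgeo 0).1
  simp only [add_zero] at hs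
  have hsplit := hs.sum_add_tsum_nat_add (k + 1)
  obtain ⟨_, htail⟩ := Schedule.window_tail_le (R := TowerRates.wide) (r := 1 / 3) (by norm_num)
    (by norm_num) hgeo (k + 1)
  have hA : 0 < TowerRates.wide.A k := TowerRates.wide.A_pos k
  have hwk : TowerRates.wide.window (k + 1) / (1 - 1 / 3) ≤ 32 / TowerRates.wide.A k := by
    rw [div_le_div_iff₀ (by norm_num) hA]
    have := hclock k
    nlinarith
  unfold Schedule.windowTime
  linarith

/-- **THE BOX SCHEDULE** on the wide-base rates: the rigid window clock (`τ₀ = 1`, `c₃ = 32`), the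
registered constants `c₁ = 1`, `c₂ = 5/3`, `c₅ = 4bβ`, push constant `c₄ ≤ 1`, radius `ρ`, the DATUM
`u₀` (smooth, compactly supported, zero outside `B̄(0, ρ)`) and the FORCE `F` (smooth on `ℝ × ℝ³`,
compact space-time support, zero outside the ball, zero from `τ₁` on, `‖F‖ ≤ c₄ Y₀` on the first
window `[1, τ₁]`). Label loops and scheduled circulations are constants (the route margin does not read
them). [cite: Palasek2026ElementaryModel, §3.3] -/
def Schedule.ofBox (u₀ : EuclideanSpace ℝ (Fin 3) → EuclideanSpace ℝ (Fin 3))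
    (F : ℝ → EuclideanSpace ℝ (Fin 3) → EuclideanSpace ℝ (Fin 3)) (ρ c₄ : ℝ) (hc₄ : c₄ ≤ 1)
    (hu₀ : ContDiff ℝ ∞ u₀) (hu₀c : HasCompactSupport u₀)
    (hF : ContDiff ℝ ∞ (uncurry F)) (hFc : HasCompactSupport (uncurry F))
    (hFT : ∀ t, Host.τfirst ≤ t → ∀ x, F t x = 0)
    (hpush : ∀ t ∈ Icc (1 : ℝ) Host.τfirst, ∀ x, ‖F t x‖ ≤ c₄ * TowerRates.wide.Y 0) :
    Schedule TowerRates.wide where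
  T := 1 + ∑' k, TowerRates.wide.window k
  τ := Schedule.windowTime TowerRates.wide
  τ_zero_pos := by rw [Host.windowTime_zero]; exact one_pos
  τ_lt_succ := fun k => by
    rw [Schedule.windowTime_succ]
    have := TowerRates.wide.window_pos k
    linarith
  τ_lt_T := windowTime_lt_T
  c₁ := 1
  c₂ := 5 / 3
  c₃ := 32
  c₄ := c₄
  c₅ := 4 * TowerRates.wide.b * TowerRates.wide.β
  c₁_pos := one_pos
  c₄_le := hc₄
  c₅_le := le_rfl
  gap := by
    have h := TowerRates.wide_sep 0
    have hY0 := Host.wide_Y_zero_pos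
    linarith
  radius := ρ
  clock := T_sub_windowTime_le
  u₀ := u₀
  datum_decay := HasRapidSpatialDecay.of_hasCompactSupport hu₀ hu₀c
  f := F
  force_smooth := isSmoothOnHalfSpace_of_contDiff hF
  force_decay := hasRapidSpaceTimeDecay_of_hasCompactSupport hF hFc
  force_silent := fun t ht x =>
    hFT t ((windowTime_lt_T 1).le.trans ht) x
  push_small := by
    intro k t ht x
    rcases Nat.eq_zero_or_pos k with hk | hk
    · subst hk
      rw [Host.windowTime_zero] at ht
      exact hpush t ⟨ht.1, ht.2⟩ x
    · have h1 : Host.τfirst ≤ t := le_trans (Host.windowTime_mono hk) ht.1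
      rw [hFT t h1 x, norm_zero]
      have hY : 0 < TowerRates.wide.Y k := Real.rpow_pos_of_pos (TowerRates.wide.N_pos k) _
      have hc0 : 0 ≤ c₄ := by
        have h := hpush 1 ⟨le_rfl, by rw [Host.τfirst_eq]; linarith [Host.wfirst_pos]⟩ 0
        have hY0 := Host.wide_Y_zero_pos
        nlinarith [norm_nonneg (F 1 0)]
      positivity
  loop := fun _ _ => 0
  loop_smooth := fun _ => contDiff_const
  loop_closed := fun _ => rfl
  Φ := fun _ => 1
  Φ_pos := fun _ => one_pos

/-! ## §3 Field lemmas and the register clauses -/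

namespace Schedule

section OfBox

variable {u₀ : EuclideanSpace ℝ (Fin 3) → EuclideanSpace ℝ (Fin 3)}
  {F : ℝ → EuclideanSpace ℝ (Fin 3) → EuclideanSpace ℝ (Fin 3)} {ρ c₄ : ℝ} (hc₄ : c₄ ≤ 1)
  (hu₀ : ContDiff ℝ ∞ u₀) (hu₀c : HasCompactSupport u₀)
  (hF : ContDiff ℝ ∞ (uncurry F)) (hFc : HasCompactSupport (uncurry F))
  (hFT : ∀ t, Host.τfirst ≤ t → ∀ x, F t x = 0)
  (hpush : ∀ t ∈ Icc (1 : ℝ) Host.τfirst, ∀ x, ‖F t x‖ ≤ c₄ * TowerRates.wide.Y 0)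

/-- The force of the box schedule is `F`. [folklore] -/
theorem ofBox_f : (ofBox u₀ F ρ c₄ hc₄ hu₀ hu₀c hF hFc hFT hpush).f = F := rfl

/-- The datum of the box schedule is `u₀`. [folklore] -/
theorem ofBox_u₀ : (ofBox u₀ F ρ c₄ hc₄ hu₀ hu₀c hF hFc hFT hpush).u₀ = u₀ := rfl

/-- The readouts of the box schedule are the window clock. [folklore] -/
theorem ofBox_τ : (ofBox u₀ F ρ c₄ hc₄ hu₀ hu₀c hF hFc hFT hpush).τ =
    Schedule.windowTime TowerRates.wide := rfl

/-- `τ 0 = 1`. [folklore] -/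
theorem ofBox_τ_zero : (ofBox u₀ F ρ c₄ hc₄ hu₀ hu₀c hF hFc hFT hpush).τ 0 = 1 :=
  Host.windowTime_zero

/-- `τ 1 = τ₁`. [folklore] -/
theorem ofBox_τ_one : (ofBox u₀ F ρ c₄ hc₄ hu₀ hu₀c hF hFc hFT hpush).τ 1 = Host.τfirst := rfl

/-- The blow-up time of the box schedule. [folklore] -/
theorem ofBox_T : (ofBox u₀ F ρ c₄ hc₄ hu₀ hu₀c hF hFc hFT hpush).T =
    1 + ∑' k, TowerRates.wide.window k := rfl

/-- The radius of the box schedule is `ρ`. [folklore] -/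
theorem ofBox_radius : (ofBox u₀ F ρ c₄ hc₄ hu₀ hu₀c hF hFc hFT hpush).radius = ρ := rfl

/-- `c₁ = 1`. [folklore] -/
theorem ofBox_c₁ : (ofBox u₀ F ρ c₄ hc₄ hu₀ hu₀c hF hFc hFT hpush).c₁ = 1 := rfl

/-- `c₂ = 5/3`. [folklore] -/
theorem ofBox_c₂ : (ofBox u₀ F ρ c₄ hc₄ hu₀ hu₀c hF hFc hFT hpush).c₂ = 5 / 3 := rfl

/-- The push constant is the prescribed `c₄`. [folklore] -/
theorem ofBox_c₄ : (ofBox u₀ F ρ c₄ hc₄ hu₀ hu₀c hF hFc hFT hpush).c₄ = c₄ := rfl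

/-- `c₅ = 4bβ`. [folklore] -/
theorem ofBox_c₅ : (ofBox u₀ F ρ c₄ hc₄ hu₀ hu₀c hF hFc hFT hpush).c₅ =
    4 * TowerRates.wide.b * TowerRates.wide.β := rfl

/-- **RIGID** (window equality, `c₅ = 4bβ`, `c₁ = 1`, `c₂ = 5/3` — by construction). [folklore] -/
theorem ofBox_rigid : (ofBox u₀ F ρ c₄ hc₄ hu₀ hu₀c hF hFc hFT hpush).Rigid where
  window_eq := fun k => by
    show Schedule.windowTime TowerRates.wide (k + 1) = Schedule.windowTime TowerRates.wide k +
      4 * TowerRates.wide.b * TowerRates.wide.β * Real.log (TowerRates.wide.N (k + 1)) /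
        TowerRates.wide.A k
    rw [Schedule.windowTime_succ]
    rfl
  c₅_eq := rfl
  c₁_eq := rfl
  c₂_eq := rfl

/-- **QUIET** (the force vanishes from `τ 1 = τ₁` on). [folklore] -/
theorem ofBox_quiet : (ofBox u₀ F ρ c₄ hc₄ hu₀ hu₀c hF hFc hFT hpush).Quiet := by
  intro t ht
  funext x
  exact hFT t ht x

/-- **PINNED** with `Λ = 8`, `θ = 6/5`, as soon as datum and force are confined to `B̄(0, ρ)`
(`c₄ ≤ 1`; `Schedule.Rigid.pins_of_push_le_one`). [folklore] -/
theorem ofBox_pins (hu₀ρ : ∀ x, ρ < ‖x‖ → u₀ x = 0) (hFρ : ∀ t x, ρ < ‖x‖ → F t x = 0) :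
    (ofBox u₀ F ρ c₄ hc₄ hu₀ hu₀c hF hFc hFT hpush).Pins 8 (6 / 5) :=
  (ofBox_rigid hc₄ hu₀ hu₀c hF hFc hFT hpush).pins_of_push_le_one hc₄
    (fun x hx => hu₀ρ x hx) (fun t x hx => hFρ t x hx)

/-- The box schedule, being rigid with `c₄ ≤ 1`, moves velocities by at most `c₄ Y_k w_k ≤ 1/4` per
window — the push is never the resource (`Schedule.Rigid.push_impulse_le`). [folklore] -/
theorem ofBox_push_impulse_le (k : ℕ) :
    (ofBox u₀ F ρ c₄ hc₄ hu₀ hu₀c hF hFc hFT hpush).c₄ * TowerRates.wide.Y k *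
        ((ofBox u₀ F ρ c₄ hc₄ hu₀ hu₀c hF hFc hFT hpush).τ (k + 1) -
          (ofBox u₀ F ρ c₄ hc₄ hu₀ hu₀c hF hFc hFT hpush).τ k) ≤ 1 / 4 :=
  (ofBox_rigid hc₄ hu₀ hu₀c hF hFc hFT hpush).push_impulse_le hc₄ k

end OfBox

end Schedule

end Summit.NavierStokesRegularity.FluidComputer.PalasekTowerClayBridge

end
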